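import Summits.BirchSwinnertonDyer.Rank1Residual.O6.KatoLocalIndexTower
import HarnessLib

/-!
# O6 — the LOCAL NORM INDEX `ι_n` along the cyclotomic `ℤ₃`-tower: LEMMA D (genus formula for Ш), THEOREM α
# (detection / cyclicity / lower bound), THEOREM β (Berger: universal norms vanish ⇒ `ι_n → ∞`) and the census item
# C-O6-NI — typed over an interface, EVIDENCE / THEOREM-CANDIDATE labelled (o6-r1 GEN 17 (T1); 0 Literature facts)
(cell `b2b-bsdres`, lane CLASS-CLOSURE, class O6, planner o6-r1 GEN 17 — memo `HOME/b2b-bsdres-o6-r1/gen17/O6-GEN17.md`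
 §1 (LEMMA D, THEOREM α), §2 (THEOREM β), §3 (census C-O6-NI), §4.3 (typed-target text); typer of record cc-typer-5 GEN 11.)

HONEST FRAMING (cell `b2b-bsdres`, verbatim in every file): the goal of the cell is to DELETE the COMBINATION-SHAPED
residual classes of the Birch–Swinnerton-Dyer formula for ALL analytic-rank `≤ 1` elliptic curves over `ℚ` — "full BSD
formula for every rank `≤ 1` curve in class `C`" assembled STRICTLY from published theorems — so that the rank-`≤ 1`
remainder becomes exactly the CONSTRUCTION-SHAPED classes, which are TYPED (missing-input `Prop`s), NOT attempted.
Lane CLASS-CLOSURE: census output is EVIDENCE / conjecture items with held-out validation, never a Literature fact.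

SETTING (memo §1). `k_n` = the `n`-th layer of the cyclotomic `ℤ₃`-extension of `ℚ` (`κ : ZpExtension ℚ 3`, `κ.IsCyclotomic`),
`G_n = Gal(k_n/ℚ)`, `𝔭 ∣ 3`, `U_n := W(k_{n,𝔭}) ⊗ ℤ₃`, and for `m ≤ n` the LOCAL NORM INDEX `ι_{n,m}(W) := ord₃ [U_m : N_{k_n/k_m} U_n]`
(`ι_n := ι_{n,0}`). Hypotheses of LEMMA D: (a) `W(k_n)` finite, (b) `Ш(W/ℚ)[3^∞]` finite, (c) `W(ℚ)[3] = 0`, (d) `3 ∤ c_ℓ` (`ℓ ≠ 3`),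
(H3) `W(ℚ₃)[3] = 0`. In the TREE's currency (a)+(b) at level `n` read "`Sel_{3^∞}(W/k_n)` finite" (`Finite (W.selmerLayer κ n)`;
⇐ Kato Cor. 14.3 under NV_n), and then `Ш(W/k_j)[3^∞] = Sel_{3^∞}(W/k_j)` for `j ≤ n` (`W(k_j)` is finite, `W(k_j)[3] = 0` by (c) and
the 3-group argument), so every statement below is phrased with `W.selmerLayer κ n` and its FIXED PART under `Gal(ℚ̄/k_m)` acting by
conjugation (`W.conjH1`, the tree's action on `H¹(k_n, W[3^∞])`) — `selmerLayerFixed W κ n m` (§1, a definition, not an interface).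

WHAT IS TYPED.
* §1 `layerCohomologyFixed` / `selmerLayerFixed` (definitions: `H¹(k_n, W[3^∞])^{Gal(k_n/k_m)}`, `Sel_{3^∞}(W/k_n)^{Gal(k_n/k_m)}`).
* §2 D-O6-NI as an INTERFACE `NormIndexDatum W` (`iota n m = ι_{n,m}`) with a realisation predicate `realN` (section variable) — the
  local points `W(k_{n,𝔭})`, their norm maps and `⊗ ℤ₃` have no tree vocabulary (same reason as `LocalTowerDatum`, D-O6-LT); the
  instrument of record is `gen17/ni/c_o6_ni.py` (formal-group logarithm to precision, exact Smith form).
* §3 **LEMMA D `GenusFormulaShaThree`** (THEOREM-CANDIDATE; memo §1 proof: inflation–restriction with `W(k_n)[3] = 0`, Lang's theorem +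
  (d) away from `3`, the Selmer-structure comparison / Cassels–Poitou–Tate sequence [Mazur–Rubin 2004 Thm 2.3.4; Česnavičius
  arXiv:1408.1151 §4], Herbrand quotient via `log_ω` and the normal basis theorem, Tate local duality for cyclicity):
  `#Sel_{3^∞}(W/k_n)^{Gal(k_n/k_m)} = #Sel_{3^∞}(W/k_m) · 3^{ι_{n,m}}` (absolute `m = 0` and relative versions at once).
* §4 **THEOREM α** on CORE rows (`Sel_{3^∞}(W/ℚ) = 0`): (α1) `#X^{G_n} = 3^{ι_n}` PROVED from LEMMA D (`card_selmerLayerFixed_of_core`);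
  (α2) `NormIndexDetectsShaThree` (`X = 0 ⟺ ι_n = 0`; fixed points of a 3-group), (α3) `ShaCyclicOverGroupRingThree` (`X` is a cyclic
  `ℤ₃[G_n]`-module: Cassels–Tate perfect alternating `G_n`-invariant + Nakayama), (α4) `ShaLowerBoundNormIndexThree` (`#X ≥ 3^{2ι_n}`:
  `X ≅ N ⊕ N`) as THEOREM-CANDIDATE nodes; (α5) PROVED bookkeeping `two_mul_iota_le_of_upperBound` (with Kato's bound
  `#X = 3^m`, `m ≤ e_n^{an}`: `2ι_n ≤ e_n^{an}` — the FORCED CONGRUENCE of twisted L-values).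
* §5 **THEOREM β `UniversalNormsVanishPotSSThree`** (THEOREM-CANDIDATE: Berger, Bull. SMF 133 (2005) Thm 1 [universal norms of a de Rham
  `V` with no `Gal(ℚ̄₃/ℚ₃(μ_{3^∞}))`-fixed subquotient live in `Fil¹`] + (β1) `V₃W|G_ℚ₃` irreducible for potentially supersingular `W`
  ⇒ no norm-compatible local points ⇒ `ι_n → ∞`); PROVED corollary (β3) `card_selmerLayerFixed_tendsto_atTop` (LEMMA D + β ⇒
  `#Sel_{3^∞}(W/k_n)^{G_n} → ∞` along the levels where it is finite: unconditional Ш-GROWTH in a FIXED `ℤ₃`-tower).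
* §6 census item **`NormIndexDetectsAnalyticShaThree`** (C-O6-NI, conjecture, EVIDENCE): on CORE ∧ H3 ∧ NV_n rows `ι_n ≥ 1 ⟺ e_n^{an} > 0`
  (`e_n^{an}` = GEN 16's `katoLocalIndexAn`); it is (α2) + BSD₃(`W/k_n`) for the Ш-term, hence a SHADOW of `TowerDescentOfKMCThree`.
NOT typed: T-O6-G17-J `CyclicShaLength` (`e_n^{an} = ord₃ #(ℤ₃[G_n]/J_n)`: the ideal `J_n` has no vocabulary and no instrument yet —
memo §4.4 "OPEN"); the LADDER closure rule of §4.1 (scorer-level bookkeeping); (α6).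
EVIDENCE (memo §0, §3; prereg `gen17/ni/NI-PREREG*.md`, scorer `score_ni.py`): C-O6-NI island `n ≤ 2` 171/171, `n = 3` 85/85 · 12/12 ·
85/85, KF5 held-out 46/46, 0 LADDER violations on 302 row-levels; LADDER ⇒ `#Ш(W/k_n)[3^∞] = 3^{e_n^{an}}` EXACT on 281 row-levels (up to
`3^{12}`) without KMC₃; calibration 17a1/32a1 (good ss): `ι = 0,0,1,1`; "X elementary" REFUTED on 7 rows. Falsifier of each node: one
realised row violating its display. PRESEARCH (planner §1, corpus fts+vec + galaxy, labelled there): genus-type formulas in cyclic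
extensions in print for other purposes (Česnavičius 1408.1151 §4–5, Brau 1401.3304, Yu 2010, Ouyang–Xie 2022/2024, Mazur 1972,
Greenberg LNM 1716 §3); universal norms: Perrin-Riou 2000, Berger 2005 [corpus: paper:arxiv-math_0309196 p.3 Thm 1]; the use of `ι_n` as an
exact computable detector of `Ш(W/k_n)[3]` at an additive `3` and its confrontation with twisted L-values: NOT FOUND.
-/

set_option autoImplicit false

noncomputable section

open scoped Classical

open Filter WeierstrassCurve Literature.NumberTheory.EllipticCurves
  Literature.NumberTheory.EllipticCurves.Rank1Residual
  Literature.NumberTheory.EllipticCurves.Rank1Residual.Typed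
  Summit.BirchSwinnertonDyer.Rank1Residual.Additive

namespace Summit.BirchSwinnertonDyer.Rank1Residual.O6

/-! ## §1 Fixed parts of the layer cohomology and of the layer Selmer group (definitions) -/

section Fixed

variable (W : WeierstrassCurve ℚ) (κ : ZpExtension ℚ 3)

/-- `H¹(k_n, W[3^∞])^{Gal(k_n/k_m)}`: the classes in `H¹(Gal(ℚ̄/k_n), W[3^∞])` (`W.subgroupH1 3 (κ.layerSubgroup n)`) fixed by
the conjugation action `W.conjH1` of every `σ ∈ Gal(ℚ̄/k_m)` (`κ.layerSubgroup m`; `m = 0` is all of `Gal(ℚ̄/ℚ)` by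
`ZpExtension.layerSubgroup_zero`). Inner elements act trivially (Serre, *Local Fields* VII §5 Prop. 3), so for `m ≤ n` this is
the `Gal(k_n/k_m)`-invariants. The layer analogue of the tree's `layerInvariants` (which lives over `k_∞`). [folklore] -/
def layerCohomologyFixed (n m : ℕ) : AddSubgroup (W.subgroupH1 3 (κ.layerSubgroup n)) :=
  ⨅ σ ∈ κ.layerSubgroup m, (W.conjH1 3 (κ.layerSubgroup n) σ - AddMonoidHom.id _).ker

/-- Membership: fixed by `conj_σ` for every `σ ∈ Gal(ℚ̄/k_m)`. [folklore] -/
theorem mem_layerCohomologyFixed_iff (n m : ℕ) (s : W.subgroupH1 3 (κ.layerSubgroup n)) :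
    s ∈ layerCohomologyFixed W κ n m ↔ ∀ σ ∈ κ.layerSubgroup m, W.conjH1 3 (κ.layerSubgroup n) σ s = s := by
  simp [layerCohomologyFixed, AddSubgroup.mem_iInf, AddMonoidHom.mem_ker, sub_eq_zero]

/-- `Sel_{3^∞}(W/k_n)^{Gal(k_n/k_m)}` = `W.selmerLayer κ n ⊓ layerCohomologyFixed W κ n m`. Under LEMMA D's hypotheses
(`W(k_n)` finite, `W(k_n)[3] = 0`) this is `Ш(W/k_n)[3^∞]^{Gal(k_n/k_m)}`. [folklore] -/
def selmerLayerFixed (n m : ℕ) : AddSubgroup (W.subgroupH1 3 (κ.layerSubgroup n)) :=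
  W.selmerLayer κ n ⊓ layerCohomologyFixed W κ n m

/-- The fixed part is a subgroup of the layer Selmer group. [folklore] -/
theorem selmerLayerFixed_le (n m : ℕ) : selmerLayerFixed W κ n m ≤ W.selmerLayer κ n := inf_le_left

/-- Shrinking the acting group enlarges the fixed part: `m ≤ m'` ⇒ `Sel^{Gal(k_n/k_m)} ≤ Sel^{Gal(k_n/k_{m'})}`. [folklore] -/
theorem selmerLayerFixed_mono (n : ℕ) {m m' : ℕ} (h : m ≤ m') :
    selmerLayerFixed W κ n m ≤ selmerLayerFixed W κ n m' := by
  refine inf_le_inf_left _ ?_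
  intro s hs
  rw [mem_layerCohomologyFixed_iff] at hs ⊢
  exact fun σ hσ => hs σ (κ.layerSubgroup_antitone h hσ)

end Fixed

/-! ## §2 D-O6-NI — the local norm index as an INTERFACE -/

/-- **D-O6-NI (definition request; INTERFACE, nothing constructed).** The local norm indices of `W/ℚ` along the cyclotomic
`ℤ₃`-tower at the prime above `3`: `iota n m = ι_{n,m}(W) := ord₃ [U_m : N_{k_{n,𝔭}/k_{m,𝔭}} U_n]`, `U_j = W(k_{j,𝔭}) ⊗ ℤ₃`
(`m ≤ n` intended; `ι_n = iota n 0`, `ι_{n,n−1} = iota n (n−1)` = the memo's columns `iota`, `iota_rel`). Local, computable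
(instrument `gen17/ni/c_o6_ni.py`: formal-group logarithm + exact Smith form; validated on 17a1/32a1 and against the Pollack exponent
through LEMMA D). No tree vocabulary for `W(k_{n,𝔭})` and its norm maps (cf. `LocalTowerDatum`, D-O6-LT), hence an interface; to be
read under a realisation hypothesis `realN W N`. [folklore] -/
structure NormIndexDatum (W : WeierstrassCurve ℚ) where
  /-- `iota n m = ι_{n,m} = ord₃ [U_m : N U_n]` (`m ≤ n`). -/
  iota : ℕ → ℕ → ℕ

/-- The SHAPE a realisation predicate must have: one datum per curve, and `ι_{n,n} = 0`. A HYPOTHESIS on `realN`. [folklore] -/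
def NormIndexDatum.RealisedShape
    (realN : ∀ (W : WeierstrassCurve ℚ) [W.IsElliptic] [W.IsGloballyMinimal], NormIndexDatum W → Prop) : Prop :=
  ∀ (W : WeierstrassCurve ℚ) [W.IsElliptic] [W.IsGloballyMinimal],
    (∃! N : NormIndexDatum W, realN W N) ∧ ∀ N : NormIndexDatum W, realN W N → ∀ n, N.iota n n = 0

variable (real : ∀ (W : WeierstrassCurve ℚ) [W.IsElliptic] [W.IsGloballyMinimal], SignedFloorDatum W → Prop)
variable (realT : ∀ (W : WeierstrassCurve ℚ) [W.IsElliptic] [W.IsGloballyMinimal], LocalTowerDatum W → Prop)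
variable (realN : ∀ (W : WeierstrassCurve ℚ) [W.IsElliptic] [W.IsGloballyMinimal], NormIndexDatum W → Prop)

/-! ## §3 LEMMA D — the genus formula (THEOREM-CANDIDATE) -/

/-- **LEMMA D `GenusFormulaShaThree` — genus formula for Ш in the cyclotomic 3-tower (o6-r1 GEN 17 §1; THEOREM-CANDIDATE with a
complete paper proof in the memo; `@[conjecture]` until a kernel proof; nothing conjectural enters).** For `W/ℚ` with (c) `W(ℚ)[3] = 0`,
(d) `3 ∤ c_ℓ(W)` for `ℓ ≠ 3`, (H3) `W(ℚ₃)[3] = 0`, the cyclotomic `ℤ₃`-extension `κ`, levels `m ≤ n` with `Sel_{3^∞}(W/k_n)` finite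
(⇐ NV_n, Kato Cor. 14.3), and the norm-index datum `N` of `W`:
`#Sel_{3^∞}(W/k_n)^{Gal(k_n/k_m)} = #Sel_{3^∞}(W/k_m) · 3^{ι_{n,m}(W)}` — i.e. `0 → Ш(W/k_m)[3^∞] → Ш(W/k_n)[3^∞]^{Gal} → ℤ/3^{ι_{n,m}} → 0`
(Remark (iv): the relative version has the same proof over the base `k_m`; (d) persists up the tower). The reduction type at `3` is
NOT used: `ι` carries all of it. Inputs by name: inflation–restriction, Lang's theorem [Mazur 1972 / Milne ADT I.3.8], Selmer-structure
comparison [Mazur–Rubin 2004 Thm 2.3.4] = CPT sequence [Česnavičius arXiv:1408.1151 §4], Herbrand quotient (`log_ω`, normal basis),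
Tate local duality. [folklore] -/
@[conjecture] def GenusFormulaShaThree : Prop :=
  ∀ (W : WeierstrassCurve ℚ) [W.IsElliptic] [W.IsGloballyMinimal] (N : NormIndexDatum W),
    (∀ P : W.toAffine.Point, 3 • P = 0 → P = 0) →
    (∀ (ℓ : ℕ) [Fact ℓ.Prime], ℓ ≠ 3 → ¬ 3 ∣ (W.baseChange ℚ_[ℓ]).localTamagawaNumber ℤ_[ℓ]) →
    NoRationalThreeTorsionOverQ3 W → realN W N →
      ∀ {κ : ZpExtension ℚ 3}, κ.IsCyclotomic → ∀ n m, m ≤ n → Finite (W.selmerLayer κ n) →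
        Nat.card (selmerLayerFixed W κ n m) = Nat.card (W.selmerLayer κ m) * 3 ^ N.iota n m

variable {realN} in
/-- **(α1), PROVED from LEMMA D.** On a CORE row (`Sel_{3^∞}(W/ℚ) = 0`, i.e. rank `0` and `Ш(W/ℚ)[3^∞] = 0`; layer `0` of `κ` is `ℚ`):
`#Sel_{3^∞}(W/k_n)^{G_n} = 3^{ι_n(W)}`. [folklore] -/
theorem card_selmerLayerFixed_of_core (hD : GenusFormulaShaThree realN) (W : WeierstrassCurve ℚ) [W.IsElliptic]
    [W.IsGloballyMinimal] (N : NormIndexDatum W) (hc : ∀ P : W.toAffine.Point, 3 • P = 0 → P = 0)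
    (hd : ∀ (ℓ : ℕ) [Fact ℓ.Prime], ℓ ≠ 3 → ¬ 3 ∣ (W.baseChange ℚ_[ℓ]).localTamagawaNumber ℤ_[ℓ])
    (h3 : NoRationalThreeTorsionOverQ3 W) (hN : realN W N) {κ : ZpExtension ℚ 3} (hκ : κ.IsCyclotomic) (n : ℕ)
    (hfin : Finite (W.selmerLayer κ n)) (hcore : Nat.card (W.selmerLayer κ 0) = 1) :
    Nat.card (selmerLayerFixed W κ n 0) = 3 ^ N.iota n 0 := by
  rw [hD W N hc hd h3 hN hκ n 0 (Nat.zero_le n) hfin, hcore, one_mul]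

/-! ## §4 THEOREM α — consequences on CORE rows (THEOREM-CANDIDATES; (α5) proved bookkeeping) -/

/-- **(α2) `NormIndexDetectsShaThree` — the norm index DETECTS Ш (THEOREM-CANDIDATE; memo §1 THEOREM α).** On a CORE row with
(c), (d), (H3) and `Sel_{3^∞}(W/k_n)` finite: `Ш(W/k_n)[3^∞] = 0 ⟺ ι_n(W) = 0` (a 3-group acting on a 3-group: `#X ≡ #X^{G_n} (mod 3)`,
and `#X^{G_n} = 3^{ι_n}` by (α1)). [folklore] -/
@[conjecture] def NormIndexDetectsShaThree : Prop :=
  ∀ (W : WeierstrassCurve ℚ) [W.IsElliptic] [W.IsGloballyMinimal] (N : NormIndexDatum W),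
    (∀ P : W.toAffine.Point, 3 • P = 0 → P = 0) →
    (∀ (ℓ : ℕ) [Fact ℓ.Prime], ℓ ≠ 3 → ¬ 3 ∣ (W.baseChange ℚ_[ℓ]).localTamagawaNumber ℤ_[ℓ]) →
    NoRationalThreeTorsionOverQ3 W → realN W N →
      ∀ {κ : ZpExtension ℚ 3}, κ.IsCyclotomic → Nat.card (W.selmerLayer κ 0) = 1 → ∀ n, Finite (W.selmerLayer κ n) →
        (Nat.card (W.selmerLayer κ n) = 1 ↔ N.iota n 0 = 0)

/-- **(α3) `ShaCyclicOverGroupRingThree` — Ш is a CYCLIC `ℤ₃[G_n]`-module (THEOREM-CANDIDATE; memo §1 (α3): the Cassels–Tate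
pairing is perfect, alternating and `G_n`-invariant, so `X_{G} ≅ (X^{G})^∨` is cyclic by (α1), then Nakayama).** Typed as: some
class `s ∈ Sel_{3^∞}(W/k_n)` has `Gal(ℚ̄/ℚ)`-orbit (under `conjH1`) generating the whole (finite) Selmer group as an additive group
(`ℤ₃[G_n]·s = X`). REFUTED finer shape "one Jordan block / X elementary" on 7 rows — not this statement. [folklore] -/
@[conjecture] def ShaCyclicOverGroupRingThree : Prop :=
  ∀ (W : WeierstrassCurve ℚ) [W.IsElliptic] [W.IsGloballyMinimal] (N : NormIndexDatum W),
    (∀ P : W.toAffine.Point, 3 • P = 0 → P = 0) →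
    (∀ (ℓ : ℕ) [Fact ℓ.Prime], ℓ ≠ 3 → ¬ 3 ∣ (W.baseChange ℚ_[ℓ]).localTamagawaNumber ℤ_[ℓ]) →
    NoRationalThreeTorsionOverQ3 W → realN W N →
      ∀ {κ : ZpExtension ℚ 3}, κ.IsCyclotomic → Nat.card (W.selmerLayer κ 0) = 1 → ∀ n, Finite (W.selmerLayer κ n) →
        ∃ s ∈ W.selmerLayer κ n,
          AddSubgroup.closure (Set.range fun σ : Field.absoluteGaloisGroup ℚ => W.conjH1 3 (κ.layerSubgroup n) σ s) =
            W.selmerLayer κ n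

/-- **(α4) `ShaLowerBoundNormIndexThree` — `#Ш(W/k_n)[3^∞] ≥ 3^{2ι_n}` (THEOREM-CANDIDATE; memo §1 (α4): `exp X ≥ 3^{ι_n}` from (α1)
and `X ≅ M ⊕ M` abstractly by Cassels–Tate at odd `p`; hence `ι_n ≤ e_n/2`).** [folklore] -/
@[conjecture] def ShaLowerBoundNormIndexThree : Prop :=
  ∀ (W : WeierstrassCurve ℚ) [W.IsElliptic] [W.IsGloballyMinimal] (N : NormIndexDatum W),
    (∀ P : W.toAffine.Point, 3 • P = 0 → P = 0) →
    (∀ (ℓ : ℕ) [Fact ℓ.Prime], ℓ ≠ 3 → ¬ 3 ∣ (W.baseChange ℚ_[ℓ]).localTamagawaNumber ℤ_[ℓ]) →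
    NoRationalThreeTorsionOverQ3 W → realN W N →
      ∀ {κ : ZpExtension ℚ 3}, κ.IsCyclotomic → Nat.card (W.selmerLayer κ 0) = 1 → ∀ n, Finite (W.selmerLayer κ n) →
        3 ^ (2 * N.iota n 0) ≤ Nat.card (W.selmerLayer κ n)

/-- **(α5), the arithmetic: a lower bound `3^{2ι} ≤ #X`, an exact order `#X = 3^m` and an upper bound `m ≤ e` force `2ι ≤ e`.** [folklore] -/
theorem two_mul_iota_le_of_upperBound {ι c m e : ℕ} (h4 : 3 ^ (2 * ι) ≤ c) (hc : c = 3 ^ m) (hm : m ≤ e) : 2 * ι ≤ e :=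
  ((Nat.pow_le_pow_iff_right (by norm_num : 1 < 3)).mp (hc ▸ h4)).trans hm

variable {real realT realN} in
/-- **(α5) `iota_le_katoIndex` — the FORCED CONGRUENCE (PROVED bookkeeping over the two nodes).** On a persistent CORE row with
(12.5.2), H2, H3, NV_n: Kato's bound (`KatoTowerUpperBoundThree`: `#Sel = 3^m`, `m ≤ e_n^{an}`) and (α4) give `2·ι_n(W) ≤ e_n^{an}(W)`;
in particular `ι_n ≥ 1 ⇒ e_n^{an} ≥ 2`: some twist `L(W,χ,1)τ(χ̄)/Ω` with `cond χ ∣ 3^{n+1}` has positive `λ̃`-adic valuation, decided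
by the LOCAL type of `W` at `3` (memo §1 (α5)). [folklore] -/
theorem iota_le_katoIndex (hK : KatoTowerUpperBoundThree real realT) (h4 : ShaLowerBoundNormIndexThree realN)
    (W : WeierstrassCurve ℚ) [W.IsElliptic] [W.IsGloballyMinimal] (D : SignedFloorDatum W) (T : LocalTowerDatum W)
    (N : NormIndexDatum W) (hO : ClassO6 W 3) (hI : Kato2004.ImageContainsSL2 W 3)
    (hd : ∀ (ℓ : ℕ) [Fact ℓ.Prime], ℓ ≠ 3 → ¬ 3 ∣ (W.baseChange ℚ_[ℓ]).localTamagawaNumber ℤ_[ℓ])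
    (hc : ∀ P : W.toAffine.Point, 3 • P = 0 → P = 0) (h3 : NoRationalThreeTorsionOverQ3 W) (hD : real W D)
    (hT : realT W T) (hN : realN W N) (hadd : ∀ k, 1 ≤ k → T.condExpAt k ≠ 0) {κ : ZpExtension ℚ 3} (hκ : κ.IsCyclotomic)
    (hcore : Nat.card (W.selmerLayer κ 0) = 1) (ν₀ : ℤ) (ν : ℕ → ℚ) (exitOrd : ℕ → ℕ) (n : ℕ)
    (hν₀ : IsLevelZeroValuationThree W ν₀) (hNV : ∀ k, 1 ≤ k → k ≤ n → D.nu k true = some (ν k)) :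
    ∃ e : ℕ, (e : ℚ) = katoLocalIndexAn (ν₀ : ℚ) ν T (fun _ => 0) exitOrd n ∧ 2 * N.iota n 0 ≤ e := by
  obtain ⟨m, e, he, hme, hcard⟩ := hK W D T hO hI hd hc h3 hD hT hadd hκ ν₀ ν exitOrd n hν₀ hNV
  have hfin : Finite (W.selmerLayer κ n) := Nat.finite_of_card_ne_zero (by rw [hcard]; positivity)
  exact ⟨e, he, two_mul_iota_le_of_upperBound (h4 W N hc hd h3 hN hκ hcore n hfin) hcard hme⟩

/-! ## §5 THEOREM β — universal norms vanish on the potentially supersingular locus; Ш grows without bound -/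

/-- **THEOREM β `UniversalNormsVanishPotSSThree` — `ι_n(W) → ∞` (THEOREM-CANDIDATE; memo §2: (β1) `W ⊗ ℚ₃` potentially supersingular
⇒ `V₃W|G_ℚ₃` irreducible (a stable line would give a rank-1 weakly admissible sub with integral slope against Newton slopes `½, ½`) and
`V^{H} = 0` for `H = Gal(ℚ̄₃/ℚ₃(μ_{3^∞}))`; (β2) BERGER, Bull. SMF 133 (2005) 601–618, Thm 1 [corpus: paper:arxiv-math_0309196 p.3]:
universal norms of such a de Rham `V` lie in `H¹_Iw(ℚ₃, Fil¹V) = 0`, so `lim← U_n = 0` and by compactness `⋂_n N(U_n) = 0` in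
`U₀ ≅ ℤ₃` (H3)).** Typed for ADDITIVE potentially supersingular `W` at `3` — `Addv W 3` with `j = 0` or `v₃(j) > 0` (for a WILD `3`,
i.e. `ClassO6`, this is automatic: potentially good with `e` divisible by `3` forces `Aut(Ẽ) ∋` order `3`, `j̃ = 0`, supersingular in
characteristic `3` — a remark, not asserted) — and H3: `ι_n(W) → ∞`. Berger's theorem itself is a Literature-fact candidate for a
literature seat (licence), not minted here. EVIDENCE (memo §2 (β4), §3): every clean island row has `ι₃ ≥ 1`, 12 have `ι₃ = 2`;
calibration 17a1/32a1 `ι = 0,0,1,1`. [folklore] -/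
@[conjecture] def UniversalNormsVanishPotSSThree : Prop :=
  ∀ (W : WeierstrassCurve ℚ) [W.IsElliptic] [W.IsGloballyMinimal] (N : NormIndexDatum W),
    Addv W 3 → (W.j = 0 ∨ 0 < padicValRat 3 W.j) → NoRationalThreeTorsionOverQ3 W → realN W N →
      Tendsto (fun n => N.iota n 0) atTop atTop

variable {realN} in
/-- **(β3) COROLLARY, PROVED from LEMMA D + THEOREM β: unconditional Ш-growth in a FIXED `ℤ₃`-tower.** For additive potentially
supersingular `W` with (c), (d), (H3), along the cyclotomic tower with every `Sel_{3^∞}(W/k_n)` finite (⇐ NV_∞):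
`#Sel_{3^∞}(W/k_n)^{G_n} = #Sel_{3^∞}(W/ℚ)·3^{ι_n} → ∞`. (Compare the good supersingular case: Kurihara 2002, Sprung, LLZ — growth via
signed theory; here no signed object is used.) [folklore] -/
theorem card_selmerLayerFixed_tendsto_atTop (hD : GenusFormulaShaThree realN) (hβ : UniversalNormsVanishPotSSThree realN)
    (W : WeierstrassCurve ℚ) [W.IsElliptic] [W.IsGloballyMinimal] (N : NormIndexDatum W) (hA : Addv W 3)
    (hj : W.j = 0 ∨ 0 < padicValRat 3 W.j) (hc : ∀ P : W.toAffine.Point, 3 • P = 0 → P = 0)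
    (hd : ∀ (ℓ : ℕ) [Fact ℓ.Prime], ℓ ≠ 3 → ¬ 3 ∣ (W.baseChange ℚ_[ℓ]).localTamagawaNumber ℤ_[ℓ])
    (h3 : NoRationalThreeTorsionOverQ3 W) (hN : realN W N) {κ : ZpExtension ℚ 3} (hκ : κ.IsCyclotomic)
    (hfin : ∀ n, Finite (W.selmerLayer κ n)) :
    Tendsto (fun n => Nat.card (selmerLayerFixed W κ n 0)) atTop atTop := by
  have hι := hβ W N hA hj h3 hN
  have h0 : 0 < Nat.card (W.selmerLayer κ 0) := by
    haveI := hfin 0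
    exact Nat.card_pos
  rw [tendsto_atTop_atTop] at hι ⊢
  intro b
  obtain ⟨i, hi⟩ := hι b
  refine ⟨i, fun n hn => ?_⟩
  rw [hD W N hc hd h3 hN hκ n 0 (Nat.zero_le n) (hfin n)]
  calc b ≤ N.iota n 0 := hi n hn
    _ ≤ 3 ^ N.iota n 0 := (Nat.lt_pow_self (by norm_num)).le
    _ ≤ Nat.card (W.selmerLayer κ 0) * 3 ^ N.iota n 0 := Nat.le_mul_of_pos_left _ h0

/-! ## §6 Census item C-O6-NI (conjecture, EVIDENCE) -/

/-- **C-O6-NI `NormIndexDetectsAnalyticShaThree` — the norm index detects the ANALYTIC Ш (conjecture item, EVIDENCE; o6-r1 GEN 17 §3).**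
On a persistent CORE row of O6 with (12.5.2), H2, H3, data realised, and NV_n (`ν₀` via `IsLevelZeroValuationThree`, even parts
`D.nu k true = some (ν k)`, `k ≤ n`): `ι_n(W) ≥ 1 ⟺ e_n^{an}(W) > 0` (`e_n^{an}` = `katoLocalIndexAn`, GEN 16). It is (α2) + BSD₃(`W/k_n`)
for the Ш-term, i.e. a SHADOW of `TowerDescentOfKMCThree` read through LEMMA D — typed because it is what the census TESTS without any
main conjecture. EVIDENCE (prereg `gen17/ni/NI-PREREG*.md`): island `n ≤ 2` 171/171; `n = 3` 85/85 · 12/12 · 85/85; KF5 held-out 46/46;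
0 LADDER violations on 302 row-levels. Falsifier: one CORE ∧ H3 ∧ NV_n row with `ι_n ≥ 1, e_n^{an} = 0` or `ι_n = 0, e_n^{an} > 0`.
[folklore] -/
@[conjecture] def NormIndexDetectsAnalyticShaThree : Prop :=
  ∀ (W : WeierstrassCurve ℚ) [W.IsElliptic] [W.IsGloballyMinimal] (D : SignedFloorDatum W) (T : LocalTowerDatum W)
    (N : NormIndexDatum W),
    ClassO6 W 3 → Kato2004.ImageContainsSL2 W 3 →
    (∀ (ℓ : ℕ) [Fact ℓ.Prime], ℓ ≠ 3 → ¬ 3 ∣ (W.baseChange ℚ_[ℓ]).localTamagawaNumber ℤ_[ℓ]) →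
    (∀ P : W.toAffine.Point, 3 • P = 0 → P = 0) → NoRationalThreeTorsionOverQ3 W →
    Nat.card (W.selmerGroup 3) = 1 →
    real W D → realT W T → realN W N → (∀ k, 1 ≤ k → T.condExpAt k ≠ 0) →
      ∀ (ν₀ : ℤ) (ν : ℕ → ℚ) (exitOrd : ℕ → ℕ) (n : ℕ),
        IsLevelZeroValuationThree W ν₀ → (∀ k, 1 ≤ k → k ≤ n → D.nu k true = some (ν k)) →
          (1 ≤ N.iota n 0 ↔ 0 < katoLocalIndexAn (ν₀ : ℚ) ν T (fun _ => 0) exitOrd n)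

end Summit.BirchSwinnertonDyer.Rank1Residual.O6
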